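/-
Copyright: statement-level skeleton of a published paper (lit-balaban cell, Phase-2 proof seat p32 gen 44). No claims beyond
what the kernel checks below.
-/
import Literature.MathematicalPhysics.QuantumFieldTheory.Balaban1983to89.B3OnePIChainUnglue
import Literature.MathematicalPhysics.QuantumFieldTheory.Balaban1983to89.B3OnePIChainAmplitude

/-!
# B3 — T. Bałaban, *(Higgs)₂,₃ quantum fields in a finite volume. III. Renormalization*, CMP **88** (1983) 411–445
[Balaban1983Higgs3] — p. 416 [PDF 6] (1.21): (A) THE LETTERS OF A CHAIN ARE UNIQUE UP TO ISOMORPHISM — for ANY isomorphism of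
a two-leg insertion `T` onto a chain `chain P [l₁, …, l_r]` of letters, `r = numSep T` and the `k`-th letter is isomorphic to the
`k`-th piece of `T`; (B) THE INDEX BIJECTION OF THE REGROUPING — connected two-leg insertions of the model UP TO ISOMORPHISM ≃
nonempty strings of letters UP TO ISOMORPHISM («decompose» and «glue» are mutually inverse on classes), delivered also in the
shape `γ ≃ List ι` that BRICK 2 (`B3Eq121OnePIChainsLetters`, §4) consumes, the bare line `C₀^ε` ↦ `[]`

statement-level skeleton of published theorems with citation tags; proofs where landed; nothing here is a claim about
the Yang–Mills mass gap

PDF held: `paper:balaban1983-higgs-2-3-quantum-fields-finite-volume` (journal page = PDF page + 410); p. 415 L28–31 and p. 416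
L13–18 of the OCR text layer re-read this session (`lit read … --pages 5-6`).

CITATION HEADER (lean-in-tree rule).  lit-balaban TYPED SKELETON (HOME `run/shared/lean/pub/lit-balaban/`), PHASE 2, seat p32
gen 44 (unit `lit-balaban-p32`; TAKING line HOME/STATUS.md 2026-08-23T13:19:54Z, free-target protocol G.5-34(d); FILE 3 of the
item «glue ∘ decompose ≅ identity» = p32 gen 43 HANDOFF (d)(γ) — the announced files 3 `B3OnePIChainUnglueUnique` and 4
`B3OnePIChainClasses` merged into this one file to spare a gate cycle), row **B3.Eq1.19-1.22** of
`HOME/lit-balaban-r15/ROWS-B3.md` (fold owner r15, referee ref-4; head `proved` under the lead g12 HEAD WORD Q25, reading (P); an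
OPTIONAL located member of its (1.21) cell, zero head weight).  CONSUMES BY NAME: p37's `B3OnePIChainGlue.TwoLegGraph` / `chain`
(p363250), gen 43's `B3OnePIChainBlocks` (`letter`, `letter_zero`, `letter_eq_getElem`, `letter_pred`, `blockEmb`, `legEmb`,
`kind_blockEmb`, `eq_of_blockEmb_eq`, `other_legEmb*`, `legEmb_zero_legIn`, `legEmb_length_legOut`, `mem_nearLegs_chain_iff`;
p365352), this gen's `B3GraphIso` (`GraphIso`, `TwoLegGraphIso`, `refl` / `symm` / `trans`, `legOf`, `legOf_congr`, `numSep_eq`;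
p366156), `B3OnePIChainPieceGraphs` (`nearAt`, `portIn`, `portOut`, `piece`, `pieceLeg`, `liftLeg`, `Unglueable`; p366952) and
`B3OnePIChainUnglue` (`unglueIso`, `Letters`, `isoChainPieces`, `headPiece` / `tailPieces` / `letter_pieces`, `isoOfEq`,
`IsLetter`, `isLetter_iff_of_iso`, `unglueable_iff_of_iso`, `unglueable_chain`, `unglueable_of_iso`, `numSep_chain_of_letters`,
`length_eq_numSep_of_iso`, `level_chain_blockEmb_of_letters`, `forall_mem_of_forall_letter`, `isLetter_piece`,
`isLetter_letter_pieces`).  Mathlib's `Quotient` / `Setoid` / `Equiv`.  Nothing re-declared.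

THE PRINTED TEXT (verbatim).  p. 416: *"The function G^ε has a perturbative expansion of the following structure
G^ε = Σ_{n=0}^∞ C₀^ε[(−δm² + Σ^ε + ∂^{ε*}Σ₁^ε + Σ₁^{ε*}∂^ε + ∂^{ε*}Σ₂^ε∂^ε)C₀^ε]ⁿ, (1.21) where C₀^ε = (−Δ₀^ε + m²)^{−1} and
Σ^ε, Σ₁^ε, Σ₂^ε are given by amputated, one-particle-irreducible graphs of the expansion of G^ε."*  p. 415: *"Now a graph for us
is a collection of internal lines, external legs, and vertices connected in the usual sense. There is at least one internal
line, and every internal line has a vertex at each endpoint."*  Print states the regrouping (1.21) of the connected two-point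
graphs by their strings of one-particle-irreducible pieces without proof (standard formal perturbation theory); the regrouping
is a bijection only because a connected two-point graph determines its string of proper insertions.  BRICK 2
(`B3Eq121OnePIChainsLetters.sigmaSeries_eq_greenSeries_of_equiv`, p32 gen 41) proved the resummation GIVEN a bijection
`γ ≃ List ι` between an index of the connected graphs and the strings of pieces; gen 42–44 built the graph side (decomposition,
glue, blocks, isomorphisms, ungluing); THIS FILE proves the uniqueness of the letters, passes to isomorphism classes and delivers
the bijection itself.

KIND «(ours)» (G.5-54): OUR plumbing on p18's model — print provenance is claimed only for the sentences quoted above; each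
declaration's cite tag locates the printed notion it serves.
WHAT IS TYPED / PROVED (definitions with bodies + theorems; no `Prop` fact, no `sorry`; standard axioms; in part (B)
`Classical.choice` enters through `Quotient.out` / `Nonempty.some` — representatives and isomorphisms are CHOSEN, the bijection is
`noncomputable`).  Local notations `Lv T v` = `level T.G T.legIn.1 T.legOut.1 v`, `Ns T` = `numSep T.G T.legIn.1 T.legOut.1`.
(A) For a chain `chain P l` of LETTERS (`hl : ∀ k ≤ l.length, IsLetter (letter P l k)`), a two-leg insertion `T` with
`hU : Unglueable T`, and an isomorphism `e : TwoLegGraphIso T (chain P l)`: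
* `§1` `exists_blockEmb_eq_of_level` / `blockIdx` / `blockEmb_blockIdx` / `blockIdx_blockEmb` (in a chain of letters the
  vertices of level `k` are block `k`), **`isNear_chain_iff_of_letters`** (the near legs of the chain are the embedded out-legs
  of the letters before the last), **`nearAt_chain_of_letters`** (`nearAt (chain P l) k = legEmb k (letter k).legOut`).
* `§2` `letterVert` (vertex of piece `k` ↦ `e` ↦ index in block `k`; `blockEmb_letterVert`, `letterVert_injective`,
  `letterVert_surjective`), `le_length_of_le`, `letterEquiv`, **`kind_letterVert`**, **`legEmb_legOf_letterVert`** (the induced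
  leg map, embedded into the chain, is `e` on the underlying leg — by `legOf_congr`, no slot arithmetic),
  **`other_legOf_letterVert`** (lines carried: a line of the chain between two legs of block `k` is never a glue line,
  `eq_of_blockEmb_eq`), **`legMap_portIn`** / **`legMap_portOut`** (`e` carries the `k`-th separating line of `T` to the `k`-th
  glue line: near legs to near legs of the same level, `B3GraphIso.isNear_iff` + `level_eq` + gen 42's `IsNear.eq_of_level_eq`),
  **`pieceIsoLetter hl hU e k hk : TwoLegGraphIso (piece T hU k hk) (letter P l k)`**, and the summary **`letters_unique`**
  (`Unglueable T`, `l.length = numSep T`, letter `k` ≅ piece `k` for all `k`).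
(B) Classes:
* `§3` **`chainIsoOfLetterIsos`**: letterwise isomorphic strings of letters have isomorphic chains (`unglueIso` of
  `B3OnePIChainUnglue` fed with `pieceIsoLetter ∘ f`).
* `§4` CLASSES: `isoSetoid` (`T ≈ T′` iff `Nonempty (TwoLegGraphIso T T′)`), **`IsoClass nbar`** (the quotient), `mkC` (class of),
  `mkC_eq_mkC_iff`, `rep` / `mkC_rep` / `nonempty_iso_rep_mkC` / `repIso` (chosen representatives), the invariant predicates
  `IsLetterC` / `UnglueableC` (well defined by `isLetter_iff_of_iso` / `unglueable_iff_of_iso`; `isLetterC_mkC`, `unglueableC_mkC`,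
  `isLetter_rep`, `unglueable_rep`), the subtypes **`LetterClass nbar`** / **`UnglueableClass nbar`**.
* `§5` THE BIJECTION: `pieceClasses T hU` = (`⟦V_0⟧`, `[⟦V_1⟧, …, ⟦V_m⟧]`); `pieceIsoPiece` (an isomorphism `T ≅ T′` induces
  `V_k ≅ V′_k`, by `pieceIsoLetter` through `isoChainPieces`), **`pieceClasses_eq_of_iso`** (the string of piece classes is an
  isomorphism invariant); **`decompose`** (on classes, through `rep`; `decompose_mkC`: = `pieceClasses` of any representative);
  **`glue`** (class of the chain of representatives; `glue_val_eq_mkC_chain`: = the class of the chain of ANY representatives, by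
  `chainIsoOfLetterIsos`); **`classEquiv : UnglueableClass nbar ≃ LetterClass nbar × List (LetterClass nbar)`** — `left_inv` is
  «glue ∘ decompose ≅ id» (`isoChainPieces`), `right_inv` is «decompose ∘ glue ≅ id» (`pieceIsoLetter` on the glued chain:
  piece `k` ≅ letter `k` = the `k`-th representative); `classEquiv_apply` / `_symm_apply` / **`classEquiv_mkC`** /
  **`classEquiv_symm_val`**.
* `§6` THE SHAPE BRICK 2 CONSUMES: **`classEquivList : Option (UnglueableClass nbar) ≃ List (LetterClass nbar)`** (`classEquiv`
  composed with p37 g108's term index `B3OnePIChainAmplitude.chainIndexEquiv (LetterClass nbar)`; `none` = the bare line `C₀^ε`,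
  the `n = 0` term of (1.21), ↦ `[]`), `classEquivList_none` / `_some`, `length_classEquivList_some_mkC` (the class of `T` is a
  term of the `n = numSep T + 1` summand).
HONEST SCOPE.  (i) Uniqueness (A) is up to the rigid isomorphisms of `B3GraphIso` (leg slots kept).  (ii) INDEX LEVEL ONLY:
`classEquivList` has the type of the datum `e : γ ≃ List ι` of `sigmaSeries_eq_greenSeries_of_equiv`; the VALUES side is p37
g108's `B3OnePIChainAmplitude` (p368132: `Dressing.kernel`, `kernel_chain`, and `eq121_chainValue` = BRICK 2 instantiated over the
term index `Option (κ × List κ)` of a FAMILY OF DRESSED LETTERS `κ → Dressed …`, i.e. on the synthesis side).  Composing the two —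
(1.21) for the series indexed by `UnglueableClass` itself — needs a dressing of the chosen representatives `rep` and the
invariance of `Dressing.kernel` under `TwoLegGraphIso`, neither of which is in the tree; NOT done here.  (iii) The letters
are classes of `TwoLegGraph`s that are connected and proper between their ports (`IsLetter`); print's insertion `X` also has the
bare mass-counterterm letter `−δm²` (vertex (1.7), not a graph, p. 415) and distinguishes the four derivative-leg kinds
`Σ^ε, ∂^{ε*}Σ₁^ε, Σ₁^{ε*}∂^ε, ∂^{ε*}Σ₂^ε∂^ε` — neither the extra letter nor the sorting of `LetterClass` into the four kinds is done
here; two-point graphs through a `−δm²` vertex or with a vector separating line are not `Unglueable` (`B3OnePIChainUnglue`,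
HONEST SCOPE (i)) and are absent from `UnglueableClass`.  (iv) No symmetry factors, no enumeration or finiteness of classes at
fixed order; nothing analytic; the Dyson resummation of (1.19) itself is BRICK 2, not this file.
-/

namespace Literature.MathematicalPhysics.QuantumFieldTheory.Balaban1983to89.B3OnePIChainClasses

open Relation Finset B3Prop1 B3Cor23Concrete B3OnePIGraphs B3OnePIChainDecomposition B3OnePIChainPieces B3GraphGlueLegs
  B3GraphGlue B3OnePIChainGlue B3OnePIChainGlueCount B3OnePIChainBlocks B3GraphIso B3OnePIChainPieceGraphs B3OnePIChainUnglue

variable {nbar : ℕ}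

/-- `Lv T v`: the LEVEL of the vertex `v` of the two-leg insertion `T` between its ports (local notation for p32's
`B3OnePIChainDecomposition.level T.G T.legIn.1 T.legOut.1 v`). -/
local notation:max "Lv " T:max =>
  level (TwoLegGraph.G T) (Sigma.fst (TwoLegGraph.legIn T)) (Sigma.fst (TwoLegGraph.legOut T))

/-- `Ns T`: the NUMBER OF SEPARATING LINES `m` between the ports of `T` (local notation for
`B3OnePIChainDecomposition.numSep T.G T.legIn.1 T.legOut.1`). -/
local notation:max "Ns " T:max =>
  numSep (TwoLegGraph.G T) (Sigma.fst (TwoLegGraph.legIn T)) (Sigma.fst (TwoLegGraph.legOut T))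

section Unique

variable {P : TwoLegGraph nbar} {l : List (TwoLegGraph nbar)} (hl : ∀ k ≤ l.length, IsLetter (letter P l k))
include hl

/-! ## §1 The blocks of a chain of letters are its pieces: block index from the level -/

/-- kernel: in a chain of letters a vertex of level `k` lies in block `k`. [cite: Balaban1983Higgs3, (1.21) p.416] -/
theorem exists_blockEmb_eq_of_level {k : ℕ} {w : Fin (chain P l).G.nV} (hw : Lv (chain P l) w = k) :
    ∃ v : Fin (letter P l k).G.nV, blockEmb P l k v = w := by
  obtain ⟨k', hk', v, rfl⟩ := exists_blockEmb_eq P l w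
  rw [level_chain_blockEmb_of_letters hl hk'] at hw
  subst hw
  exact ⟨v, rfl⟩

/-- The index in block `k` of a vertex of level `k` of a chain of letters. [cite: Balaban1983Higgs3, (1.21) p.416] -/
noncomputable def blockIdx {k : ℕ} (w : Fin (chain P l).G.nV) (hw : Lv (chain P l) w = k) : Fin (letter P l k).G.nV :=
  (exists_blockEmb_eq_of_level hl hw).choose

/-- kernel: `blockEmb ∘ blockIdx = id`. [cite: Balaban1983Higgs3, (1.21) p.416] -/
@[simp] theorem blockEmb_blockIdx {k : ℕ} (w : Fin (chain P l).G.nV) (hw : Lv (chain P l) w = k) :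
    blockEmb P l k (blockIdx hl w hw) = w :=
  (exists_blockEmb_eq_of_level hl hw).choose_spec

/-- kernel: `blockIdx ∘ blockEmb = id`. [cite: Balaban1983Higgs3, (1.21) p.416] -/
@[simp] theorem blockIdx_blockEmb {k : ℕ} (v : Fin (letter P l k).G.nV) (h : Lv (chain P l) (blockEmb P l k v) = k) :
    blockIdx hl (blockEmb P l k v) h = v :=
  blockEmb_injective P l k (blockEmb_blockIdx hl _ _)

/-- kernel: the near legs of a chain of letters are the embedded out-legs of the letters before the last.
[cite: Balaban1983Higgs3, (1.21) p.416] -/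
theorem isNear_chain_iff_of_letters {d : Leg (chain P l).G.kind} :
    IsNear (chain P l).G (chain P l).legIn.1 (chain P l).legOut.1 d ↔
      ∃ k, k < l.length ∧ d = legEmb P l k (letter P l k).legOut := by
  obtain ⟨hP, hl'⟩ := forall_mem_of_forall_letter (Q := IsLetter) hl
  rw [← mem_nearLegs, mem_nearLegs_chain_iff hP.1 (fun T' hT' => (hl' T' hT').1) d]
  constructor
  · rintro (h1 | ⟨k, hk, x, hx, -⟩)
    · exact h1
    · have h0 : nearLegs (letter P l k).G (letter P l k).legIn.1 (letter P l k).legOut.1 = ∅ := by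
        have := (hl k hk).2
        rwa [numSep, card_eq_zero] at this
      rw [h0] at hx
      simp at hx
  · exact Or.inl

/-- kernel: the `k`-th near leg of a chain of letters is the embedded out-leg of the `k`-th letter.
[cite: Balaban1983Higgs3, (1.21) p.416] -/
theorem nearAt_chain_of_letters {k : ℕ} (hk : k < l.length) :
    nearAt (chain P l) k = legEmb P l k (letter P l k).legOut := by
  obtain ⟨hP, hl'⟩ := forall_mem_of_forall_letter (Q := IsLetter) hl
  have hconn : IsConnected (chain P l).G := isConnected_chain hP.1 (fun T' hT' => (hl' T' hT').1)
  symm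
  refine eq_nearAt hconn ((isNear_chain_iff_of_letters hl).2 ⟨k, hk, rfl⟩) ?_
  rw [fst_legEmb, level_chain_blockEmb_of_letters hl hk.le]

end Unique

/-! ## §2 Any transcription into letters is the canonical one, up to isomorphism -/

section Iso

variable {P : TwoLegGraph nbar} {l : List (TwoLegGraph nbar)} {T : TwoLegGraph nbar}

/-- kernel: an isomorphism onto a chain of letters carries the vertices of level `k` into block `k`.
[cite: Balaban1983Higgs3, (1.21) p.416] -/
theorem lvl_toEquiv_pieceEmb (e : TwoLegGraphIso T (chain P l))
    (k : ℕ) (u : Fin (pieceCard T k)) : Lv (chain P l) (e.toEquiv (pieceEmb T k u)) = k := by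
  rw [e.level_eq]; exact lvl_pieceEmb k u

/-- THE VERTEX MAP piece `k` → letter `k`: through the isomorphism into the chain, then the index in block `k`.
[cite: Balaban1983Higgs3, (1.21) p.416] -/
noncomputable def letterVert (hl : ∀ k ≤ l.length, IsLetter (letter P l k)) (e : TwoLegGraphIso T (chain P l))
    (k : ℕ) (u : Fin (pieceCard T k)) : Fin (letter P l k).G.nV :=
  blockIdx hl (e.toEquiv (pieceEmb T k u)) (lvl_toEquiv_pieceEmb e k u)

/-- kernel: the defining square of `letterVert`. [cite: Balaban1983Higgs3, (1.21) p.416] -/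
@[simp] theorem blockEmb_letterVert (hl : ∀ k ≤ l.length, IsLetter (letter P l k)) (e : TwoLegGraphIso T (chain P l))
    (k : ℕ) (u : Fin (pieceCard T k)) :
    blockEmb P l k (letterVert hl e k u) = e.toEquiv (pieceEmb T k u) :=
  blockEmb_blockIdx hl _ _

/-- kernel: `letterVert` is injective. [cite: Balaban1983Higgs3, (1.21) p.416] -/
theorem letterVert_injective (hl : ∀ k ≤ l.length, IsLetter (letter P l k)) (e : TwoLegGraphIso T (chain P l))
    (k : ℕ) : Function.Injective (letterVert hl e k) := fun u u' h => by
  have := congrArg (blockEmb P l k) h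
  rw [blockEmb_letterVert, blockEmb_letterVert] at this
  exact pieceEmb_injective k (e.toEquiv.injective this)

/-- kernel: `letterVert` is surjective (`k ≤ l.length`). [cite: Balaban1983Higgs3, (1.21) p.416] -/
theorem letterVert_surjective (hl : ∀ k ≤ l.length, IsLetter (letter P l k)) (e : TwoLegGraphIso T (chain P l))
    {k : ℕ} (hk : k ≤ l.length) : Function.Surjective (letterVert hl e k) := fun v => by
  have hw : Lv (chain P l) (blockEmb P l k v) = k := level_chain_blockEmb_of_letters hl hk v
  have hw' : Lv T (e.toEquiv.symm (blockEmb P l k v)) = k := by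
    have := e.symm.level_eq (blockEmb P l k v)
    exact this.trans hw
  refine ⟨pieceIdx (e.toEquiv.symm (blockEmb P l k v)) hw', blockEmb_injective P l k ?_⟩
  rw [blockEmb_letterVert, pieceEmb_pieceIdx, Equiv.apply_symm_apply]

/-- kernel: the number of letters is `numSep T`. [cite: Balaban1983Higgs3, (1.21) p.416] -/
theorem le_length_of_le (hl : ∀ k ≤ l.length, IsLetter (letter P l k)) (e : TwoLegGraphIso T (chain P l))
    {k : ℕ} (hk : k ≤ Ns T) : k ≤ l.length := by
  rw [length_eq_numSep_of_iso hl e]; exact hk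

/-- THE VERTEX BIJECTION piece `k` ≃ letter `k`. [cite: Balaban1983Higgs3, (1.21) p.416] -/
noncomputable def letterEquiv (hl : ∀ k ≤ l.length, IsLetter (letter P l k)) (hU : Unglueable T)
    (e : TwoLegGraphIso T (chain P l))
    (k : ℕ) (hk : k ≤ Ns T) : Fin (piece T hU k hk).G.nV ≃ Fin (letter P l k).G.nV :=
  Equiv.ofBijective (letterVert hl e k) ⟨letterVert_injective hl e k, letterVert_surjective hl e (le_length_of_le hl e hk)⟩

/-- kernel: the vertex bijection keeps the catalogue kinds. [cite: Balaban1983Higgs3, (1.21) p.416] -/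
theorem kind_letterVert (hl : ∀ k ≤ l.length, IsLetter (letter P l k)) (hU : Unglueable T) (e : TwoLegGraphIso T (chain P l))
    (k : ℕ) (hk : k ≤ Ns T) (u : Fin (piece T hU k hk).G.nV) :
    (letter P l k).G.kind (letterEquiv hl hU e k hk u) = (piece T hU k hk).G.kind u := by
  change (letter P l k).G.kind (letterVert hl e k u) = T.G.kind (pieceEmb T k u)
  rw [← kind_blockEmb P l k, blockEmb_letterVert, e.kind_eq]

/-- **the induced leg map, computed in the chain**: embedding the image leg of letter `k` into the chain gives the image under
`e` of the underlying leg of `T`. [cite: Balaban1983Higgs3, (1.21) p.416] -/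
theorem legEmb_legOf_letterVert (hl : ∀ k ≤ l.length, IsLetter (letter P l k)) (hU : Unglueable T)
    (e : TwoLegGraphIso T (chain P l))
    (k : ℕ) (hk : k ≤ Ns T) (x : Leg (piece T hU k hk).G.kind) :
    legEmb P l k (legOf (letterEquiv hl hU e k hk) (kind_letterVert hl hU e k hk) x) = e.toGraphIso.legMap (pieceLeg T k x) := by
  rw [legEmb_eq_legOf, legOf_legOf, GraphIso.legMap, pieceLeg_eq_legOf, legOf_legOf]
  exact legOf_congr _ _ (fun u => blockEmb_letterVert hl e k u) x

/-- **the lines are carried along** piece `k` → letter `k`. [cite: Balaban1983Higgs3, (1.21) p.416] -/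
theorem other_legOf_letterVert (hl : ∀ k ≤ l.length, IsLetter (letter P l k)) (hU : Unglueable T)
    (e : TwoLegGraphIso T (chain P l))
    (k : ℕ) (hk : k ≤ Ns T) (x : Leg (piece T hU k hk).G.kind) :
    (letter P l k).G.other (legOf (letterEquiv hl hU e k hk) (kind_letterVert hl hU e k hk) x) =
      ((piece T hU k hk).G.other x).map (legOf (letterEquiv hl hU e k hk) (kind_letterVert hl hU e k hk)) := by
  have hkl : k ≤ l.length := le_length_of_le hl e hk
  set F := legOf (letterEquiv hl hU e k hk) (kind_letterVert hl hU e k hk) with hF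
  have hEX : ∀ y, legEmb P l k (F y) = e.toGraphIso.legMap (pieceLeg T k y) := legEmb_legOf_letterVert hl hU e k hk
  -- a line of the chain between two legs of block `k` is not a glue line
  have notIn : ∀ Y : Leg (letter P l k).G.kind,
      (chain P l).G.other (legEmb P l k (F x)) = some (legEmb P l k Y) → F x = (letter P l k).legIn → k = 0 := by
    intro Y hY hXin
    by_contra hk0
    obtain ⟨k', rfl⟩ := Nat.exists_eq_add_one_of_ne_zero hk0
    rw [hXin, other_legEmb_succ_legIn P l (by omega)] at hY
    have h1 := congrArg Sigma.fst (Option.some.inj hY)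
    rw [fst_legEmb, fst_legEmb] at h1
    have := eq_of_blockEmb_eq P l (k := k') (k' := k' + 1) (by omega) hkl h1
    omega
  have notOut : ∀ Y : Leg (letter P l k).G.kind,
      (chain P l).G.other (legEmb P l k (F x)) = some (legEmb P l k Y) → F x = (letter P l k).legOut → l.length ≤ k := by
    intro Y hY hXout
    by_contra hkm
    rw [hXout, other_legEmb_legOut P l (lt_of_not_ge hkm)] at hY
    have h1 := congrArg Sigma.fst (Option.some.inj hY)
    rw [fst_legEmb, fst_legEmb] at h1
    have := eq_of_blockEmb_eq P l (k := k + 1) (k' := k) (by omega) hkl h1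
    omega
  cases hx : (piece T hU k hk).G.other x with
  | none =>
      rw [Option.map_none]
      cases hT : T.G.other (pieceLeg T k x) with
      | none =>
          have hC : (chain P l).G.other (legEmb P l k (F x)) = none := by
            rw [hEX, e.toGraphIso.other_legMap_eq_none_iff]; exact hT
          exact ((other_legEmb_eq_none_iff P l hkl (F x)).1 hC).1
      | some z =>
          have hz : Lv T z.1 ≠ k := (pieceOther_eq_none_iff.1 hx) z hT
          cases hL : (letter P l k).G.other (F x) with
          | none => rfl
          | some Y =>
              exfalso
              have h₁ : F x = (letter P l k).legIn → k = 0 := fun hXin => by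
                have := (letter P l k).in_ext
                rw [← hXin, hL] at this
                cases this
              have h₂ : F x = (letter P l k).legOut → l.length ≤ k := fun hXout => by
                have := (letter P l k).out_ext
                rw [← hXout, hL] at this
                cases this
              have hC := other_legEmb P l k (F x) h₁ h₂
              rw [hL, Option.map_some, hEX, e.toGraphIso.other_legMap, hT, Option.map_some] at hC
              have h1 := congrArg Sigma.fst (Option.some.inj hC)
              rw [GraphIso.fst_legMap, fst_legEmb] at h1
              have h2 := congrArg (fun w => Lv (chain P l) w) h1
              simp only [e.level_eq, level_chain_blockEmb_of_letters hl hkl] at h2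
              exact hz h2
  | some y =>
      rw [Option.map_some]
      have hT : T.G.other (pieceLeg T k x) = some (pieceLeg T k y) := pieceOther_eq_some_iff.1 hx
      have hC : (chain P l).G.other (legEmb P l k (F x)) = some (legEmb P l k (F y)) := by
        rw [hEX, hEX, e.toGraphIso.other_legMap_eq_some_iff]; exact hT
      have hO := other_legEmb P l k (F x) (notIn _ hC) (notOut _ hC)
      rw [hC] at hO
      cases hL : (letter P l k).G.other (F x) with
      | none => rw [hL] at hO; cases hO
      | some Y =>
          rw [hL, Option.map_some] at hO
          rw [legEmb_injective P l k (Option.some.inj hO)]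

/-- **the in-ports correspond**: the image of the in-port of piece `k` is the embedded in-leg of letter `k`.
[cite: Balaban1983Higgs3, (1.21) p.416] -/
theorem legMap_portIn (hl : ∀ k ≤ l.length, IsLetter (letter P l k)) (hU : Unglueable T) (e : TwoLegGraphIso T (chain P l))
    (k : ℕ) (hk : k ≤ Ns T) : e.toGraphIso.legMap (portIn T k) = legEmb P l k (letter P l k).legIn := by
  obtain ⟨hP, hl'⟩ := forall_mem_of_forall_letter (Q := IsLetter) hl
  have hconn : IsConnected (chain P l).G := isConnected_chain hP.1 (fun T' hT' => (hl' T' hT').1)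
  cases k with
  | zero => rw [portIn_zero, e.legMap_legIn]; exact (legEmb_zero_legIn P l).symm
  | succ k =>
      have hkl : k < l.length := by have := le_length_of_le hl e hk; omega
      have hk' : k < Ns T := by omega
      -- the near leg goes to the near leg of the same level: the embedded out-leg of letter `k`
      have hnear : e.toGraphIso.legMap (nearAt T k) = legEmb P l k (letter P l k).legOut := by
        rw [← nearAt_chain_of_letters hl hkl]
        refine eq_nearAt hconn ?_ ?_
        · have := (e.toGraphIso.isNear_iff (i := T.legIn.1) (j := T.legOut.1) (c := nearAt T k)).2 (nearAt_spec hU.conn hk').1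
          rwa [e.toEquiv_legIn_fst, e.toEquiv_legOut_fst] at this
        · rw [GraphIso.fst_legMap, e.level_eq]; exact (nearAt_spec hU.conn hk').2
      -- and its far leg to the far leg of the same glue line: the embedded in-leg of letter `k + 1`
      have h1 := e.toGraphIso.other_legMap_eq_some_iff.2 (other_nearAt hU.conn hk')
      rw [hnear, other_legEmb_legOut P l hkl] at h1
      rw [portIn_succ]
      exact (Option.some.inj h1).symm

/-- **the out-ports correspond**. [cite: Balaban1983Higgs3, (1.21) p.416] -/
theorem legMap_portOut (hl : ∀ k ≤ l.length, IsLetter (letter P l k)) (hU : Unglueable T) (e : TwoLegGraphIso T (chain P l))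
    (k : ℕ) (hk : k ≤ Ns T) : e.toGraphIso.legMap (portOut T k) = legEmb P l k (letter P l k).legOut := by
  obtain ⟨hP, hl'⟩ := forall_mem_of_forall_letter (Q := IsLetter) hl
  have hconn : IsConnected (chain P l).G := isConnected_chain hP.1 (fun T' hT' => (hl' T' hT').1)
  rcases Nat.lt_or_eq_of_le hk with hk' | rfl
  · have hkl : k < l.length := by rw [length_eq_numSep_of_iso hl e]; exact hk'
    rw [portOut_of_lt hk', ← nearAt_chain_of_letters hl hkl]
    refine eq_nearAt hconn ?_ ?_
    · have := (e.toGraphIso.isNear_iff (i := T.legIn.1) (j := T.legOut.1) (c := nearAt T k)).2 (nearAt_spec hU.conn hk').1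
      rwa [e.toEquiv_legIn_fst, e.toEquiv_legOut_fst] at this
    · rw [GraphIso.fst_legMap, e.level_eq]; exact (nearAt_spec hU.conn hk').2
  · rw [portOut_nsep, e.legMap_legOut]
    have key : ∀ k, k = l.length → (chain P l).legOut = legEmb P l k (letter P l k).legOut := by
      rintro k rfl
      exact (legEmb_length_legOut P l).symm
    exact key _ (length_eq_numSep_of_iso hl e).symm

/-- **THE LETTERS ARE THE PIECES, UP TO ISOMORPHISM**: for ANY isomorphism `e : T ≅ chain P [l₁, …, l_r]` onto a chain of
letters, the `k`-th letter is isomorphic, as a two-leg insertion, to the `k`-th piece of `T` — the transcription of a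
connected two-point graph as a chain of proper insertions is unique. [cite: Balaban1983Higgs3, (1.21) p.416] -/
noncomputable def pieceIsoLetter (hl : ∀ k ≤ l.length, IsLetter (letter P l k)) (hU : Unglueable T)
    (e : TwoLegGraphIso T (chain P l))
    (k : ℕ) (hk : k ≤ Ns T) : TwoLegGraphIso (piece T hU k hk) (letter P l k) where
  toEquiv := letterEquiv hl hU e k hk
  kind_eq := kind_letterVert hl hU e k hk
  map_other := other_legOf_letterVert hl hU e k hk
  map_legIn := legEmb_injective P l k (by
    rw [legEmb_legOf_letterVert]
    change e.toGraphIso.legMap (pieceLeg T k (liftLeg T k (portIn T k) _)) = _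
    rw [pieceLeg_liftLeg, legMap_portIn hl hU e k hk])
  map_legOut := legEmb_injective P l k (by
    rw [legEmb_legOf_letterVert]
    change e.toGraphIso.legMap (pieceLeg T k (liftLeg T k (portOut T k) _)) = _
    rw [pieceLeg_liftLeg, legMap_portOut hl hU e k hk])

/-- **UNIQUENESS OF THE TRANSCRIPTION (summary)**: if `T ≅ chain P [l₁, …, l_r]` with letters, then `T` is unglueable,
`r = numSep T`, and letter `k` ≅ piece `k` for every `k ≤ r`. [cite: Balaban1983Higgs3, (1.21) p.416] -/
theorem letters_unique (hl : ∀ k ≤ l.length, IsLetter (letter P l k)) (e : TwoLegGraphIso T (chain P l)) :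
    ∃ hU' : Unglueable T, l.length = Ns T ∧ ∀ k (hk : k ≤ Ns T), Nonempty (TwoLegGraphIso (piece T hU' k hk) (letter P l k)) :=
  ⟨unglueable_of_iso e.symm (unglueable_chain hl), length_eq_numSep_of_iso hl e,
    fun k hk => ⟨pieceIsoLetter hl _ e k hk⟩⟩

end Iso

/-! ## §3 Chains respect isomorphism of their letters -/

/-- **gluing isomorphic letters gives isomorphic chains**: if `P ≅ P′` and `lᵢ ≅ l′ᵢ` letter by letter (all letters), then
`chain P l ≅ chain P′ l′` (letters on the primed side suffice: the unprimed chain inherits them).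
[cite: Balaban1983Higgs3, (1.21) p.416] -/
noncomputable def chainIsoOfLetterIsos {P P' : TwoLegGraph nbar} {l l' : List (TwoLegGraph nbar)} (hlen : l.length = l'.length)
    (hl' : ∀ k ≤ l'.length, IsLetter (letter P' l' k))
    (f : ∀ k, k ≤ l.length → TwoLegGraphIso (letter P' l' k) (letter P l k)) : TwoLegGraphIso (chain P' l') (chain P l) :=
  have hU' : Unglueable (chain P' l') := unglueable_chain hl'
  have hlen' : l.length = Ns (chain P' l') := by rw [hlen, numSep_chain_of_letters hl']
  unglueIso
    { head := P
      tail := l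
      length_eq := hlen'
      iso := fun k hk =>
        (pieceIsoLetter hl' hU' (TwoLegGraphIso.refl (chain P' l')) k hk).trans
          (f k (by rw [hlen']; exact hk)) }

/-! ## §4 Isomorphism classes -/

variable (nbar) in
/-- The ISOMORPHISM relation on two-leg insertions of the model, as a setoid (`T ≈ T′` iff `Nonempty (TwoLegGraphIso T T′)`).
[cite: Balaban1983Higgs3, p.415] -/
def isoSetoid : Setoid (TwoLegGraph nbar) where
  r T T' := Nonempty (TwoLegGraphIso T T')
  iseqv := ⟨fun T => ⟨TwoLegGraphIso.refl T⟩, fun ⟨e⟩ => ⟨e.symm⟩, fun ⟨e⟩ ⟨f⟩ => ⟨e.trans f⟩⟩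

variable (nbar) in
/-- The ISOMORPHISM CLASSES of two-leg insertions (p. 415: graphs "in the usual sense"). [cite: Balaban1983Higgs3, p.415] -/
def IsoClass : Type := Quotient (isoSetoid nbar)

/-- the CLASS of an insertion up to isomorphism. [cite: Balaban1983Higgs3, p.415] -/
def mkC (T : TwoLegGraph nbar) : IsoClass nbar := Quotient.mk (isoSetoid nbar) T

/-- kernel: equal classes ⇔ isomorphic. [cite: Balaban1983Higgs3, p.415] -/
theorem mkC_eq_mkC_iff {T T' : TwoLegGraph nbar} : mkC T = mkC T' ↔ Nonempty (TwoLegGraphIso T T') :=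
  ⟨fun h => Quotient.exact h, fun h => Quotient.sound h⟩

/-- a REPRESENTATIVE of a class (chosen, `Quotient.out`). [cite: Balaban1983Higgs3, p.415] -/
noncomputable def rep (q : IsoClass nbar) : TwoLegGraph nbar := Quotient.out (s := isoSetoid nbar) q

/-- kernel: the class of the representative. [cite: Balaban1983Higgs3, p.415] -/
@[simp] theorem mkC_rep (q : IsoClass nbar) : mkC (rep q) = q := Quotient.out_eq (s := isoSetoid nbar) q

/-- kernel: the representative of the class of `T` is isomorphic to `T`. [cite: Balaban1983Higgs3, p.415] -/
theorem nonempty_iso_rep_mkC (T : TwoLegGraph nbar) : Nonempty (TwoLegGraphIso (rep (mkC T)) T) :=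
  Quotient.mk_out (s := isoSetoid nbar) T

/-- a chosen isomorphism `rep (mkC T) ≅ T`. [cite: Balaban1983Higgs3, p.415] -/
noncomputable def repIso (T : TwoLegGraph nbar) : TwoLegGraphIso (rep (mkC T)) T := (nonempty_iso_rep_mkC T).some

/-- `IsLetter` on classes. [cite: Balaban1983Higgs3, (1.21) p.416] -/
def IsLetterC (q : IsoClass nbar) : Prop :=
  Quotient.liftOn (s := isoSetoid nbar) q IsLetter (fun _ _ ⟨e⟩ => propext (isLetter_iff_of_iso e).symm)

/-- `Unglueable` on classes. [cite: Balaban1983Higgs3, (1.21) p.416] -/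
def UnglueableC (q : IsoClass nbar) : Prop :=
  Quotient.liftOn (s := isoSetoid nbar) q Unglueable (fun _ _ ⟨e⟩ => propext (unglueable_iff_of_iso e).symm)

/-- kernel. [cite: Balaban1983Higgs3, (1.21) p.416] -/
@[simp] theorem isLetterC_mkC {T : TwoLegGraph nbar} : IsLetterC (mkC T) ↔ IsLetter T := Iff.rfl

/-- kernel. [cite: Balaban1983Higgs3, (1.21) p.416] -/
@[simp] theorem unglueableC_mkC {T : TwoLegGraph nbar} : UnglueableC (mkC T) ↔ Unglueable T := Iff.rfl

/-- kernel: a representative of a letter class is a letter. [cite: Balaban1983Higgs3, (1.21) p.416] -/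
theorem isLetter_rep {q : IsoClass nbar} (h : IsLetterC q) : IsLetter (rep q) := by
  rw [← mkC_rep q] at h; exact h

/-- kernel: a representative of an unglueable class is unglueable. [cite: Balaban1983Higgs3, (1.21) p.416] -/
theorem unglueable_rep {q : IsoClass nbar} (h : UnglueableC q) : Unglueable (rep q) := by
  rw [← mkC_rep q] at h; exact h

variable (nbar) in
/-- THE LETTER CLASSES: isomorphism classes of connected insertions proper between their ports (the index set of the insertion
`X` of (1.21) on the model, graph letters). [cite: Balaban1983Higgs3, (1.21) p.416] -/
abbrev LetterClass : Type := {q : IsoClass nbar // IsLetterC q}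

variable (nbar) in
/-- THE UNGLUEABLE CLASSES: isomorphism classes of connected two-leg insertions with φ′-separating lines and line-spanning pieces
(the connected two-point graphs that (1.21) regroups, minus those through a bare `−δm²` letter).
[cite: Balaban1983Higgs3, (1.21) p.416] -/
abbrev UnglueableClass : Type := {q : IsoClass nbar // UnglueableC q}

/-! ## §5 Decomposing and gluing classes; the bijection behind the regrouping (1.21) -/

/-- kernel: the letters of `chain P l` read off the list `P :: l`. [cite: Balaban1983Higgs3, (1.21) p.416] -/
theorem isLetter_letter_of_forall {P : TwoLegGraph nbar} {l : List (TwoLegGraph nbar)} (hP : IsLetter P)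
    (hl : ∀ X ∈ l, IsLetter X) (k : ℕ) : IsLetter (letter P l k) :=
  letter_pred (P := IsLetter) hP hl k

/-- THE PIECE CLASSES of an unglueable insertion: the class of its head piece and the classes of its further pieces, in the
order of the chain. [cite: Balaban1983Higgs3, (1.21) p.416] -/
noncomputable def pieceClasses (T : TwoLegGraph nbar) (hU : Unglueable T) : LetterClass nbar × List (LetterClass nbar) :=
  (⟨mkC (headPiece T hU), (isLetter_piece hU 0 (Nat.zero_le _) : IsLetter (headPiece T hU))⟩,
    List.ofFn fun k : Fin (Ns T) => (⟨mkC (piece T hU (k + 1) k.2), isLetter_piece hU (k + 1) k.2⟩ : LetterClass nbar))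

/-- kernel: isomorphic unglueable insertions have isomorphic pieces, piece by piece (`B3OnePIChainUnglueUnique.pieceIsoLetter`
through `isoChainPieces`). [cite: Balaban1983Higgs3, (1.21) p.416] -/
noncomputable def pieceIsoPiece {T T' : TwoLegGraph nbar} (hU : Unglueable T) (hU' : Unglueable T') (e : TwoLegGraphIso T T')
    (k : ℕ) (hk : k ≤ Ns T) (hk' : k ≤ Ns T') : TwoLegGraphIso (piece T hU k hk) (piece T' hU' k hk') :=
  (pieceIsoLetter (fun k hk => isLetter_letter_pieces T' hU' k hk) hU (e.trans (isoChainPieces T' hU')) k hk).trans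
    (isoOfEq (letter_pieces T' hU' k hk'))

/-- **the piece classes are an isomorphism invariant**. [cite: Balaban1983Higgs3, (1.21) p.416] -/
theorem pieceClasses_eq_of_iso {T T' : TwoLegGraph nbar} (hU : Unglueable T) (hU' : Unglueable T') (e : TwoLegGraphIso T T') :
    pieceClasses T hU = pieceClasses T' hU' := by
  have hm : Ns T = Ns T' := (e.numSep_eq).symm
  refine Prod.ext (Subtype.ext (mkC_eq_mkC_iff.2 ⟨pieceIsoPiece hU hU' e 0 _ _⟩)) (List.ext_getElem (by simp [pieceClasses, hm]) ?_)
  intro i h₁ h₂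
  simp only [pieceClasses, List.getElem_ofFn]
  exact Subtype.ext (mkC_eq_mkC_iff.2 ⟨pieceIsoPiece hU hU' e (i + 1) _ _⟩)

/-- DECOMPOSE a class: the piece classes of a representative. [cite: Balaban1983Higgs3, (1.21) p.416] -/
noncomputable def decompose (x : UnglueableClass nbar) : LetterClass nbar × List (LetterClass nbar) :=
  pieceClasses (rep x.1) (unglueable_rep x.2)

/-- kernel: `decompose` on the class of `T` is the piece classes of `T`. [cite: Balaban1983Higgs3, (1.21) p.416] -/
theorem decompose_mkC (T : TwoLegGraph nbar) (hU : Unglueable T) :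
    decompose ⟨mkC T, unglueableC_mkC.2 hU⟩ = pieceClasses T hU :=
  pieceClasses_eq_of_iso _ hU (repIso T)

/-- kernel: the representatives of letter classes, listed, are letters. [cite: Balaban1983Higgs3, (1.21) p.416] -/
theorem isLetter_letter_rep (c : LetterClass nbar) (cs : List (LetterClass nbar)) (k : ℕ)
    (_ : k ≤ (cs.map fun c => rep c.1).length) : IsLetter (letter (rep c.1) (cs.map fun c => rep c.1) k) :=
  isLetter_letter_of_forall (isLetter_rep c.2) (fun X hX => by
    obtain ⟨c', -, rfl⟩ := List.mem_map.1 hX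
    exact isLetter_rep c'.2) k

/-- GLUE a string of letter classes: the class of the chain of representatives. [cite: Balaban1983Higgs3, (1.21) p.416] -/
noncomputable def glue (x : LetterClass nbar × List (LetterClass nbar)) : UnglueableClass nbar :=
  ⟨mkC (chain (rep x.1.1) (x.2.map fun c => rep c.1)), unglueableC_mkC.2 (unglueable_chain (isLetter_letter_rep x.1 x.2))⟩

/-- kernel: the `k`-th letter of `chain (rep c) (map rep cs)` is the representative of the `k`-th class.
[cite: Balaban1983Higgs3, (1.21) p.416] -/
theorem letter_rep_succ (c : LetterClass nbar) (cs : List (LetterClass nbar)) (i : ℕ) (hi : i < cs.length) :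
    letter (rep c.1) (cs.map fun c => rep c.1) (i + 1) = rep (cs[i]).1 := by
  rw [letter_eq_getElem _ _ (i + 1) (by simpa using hi)]
  simp

/-- **`glue` on the classes of given letters is the class of their chain** (`chainIsoOfLetterIsos`).
[cite: Balaban1983Higgs3, (1.21) p.416] -/
theorem glue_val_eq_mkC_chain {P : TwoLegGraph nbar} {l : List (TwoLegGraph nbar)} {c : LetterClass nbar}
    {cs : List (LetterClass nbar)} (hc : c.1 = mkC P) (hcs : cs.map Subtype.val = l.map mkC) :
    (glue (c, cs)).1 = mkC (chain P l) := by
  have hcl : cs.length = l.length := by simpa using congrArg List.length hcs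
  have hlen : l.length = (cs.map fun c => rep c.1).length := by rw [List.length_map, hcl]
  refine mkC_eq_mkC_iff.2 ⟨chainIsoOfLetterIsos hlen (isLetter_letter_rep c cs) fun k hk => ?_⟩
  cases k with
  | zero => exact (mkC_eq_mkC_iff.1 ((mkC_rep c.1).trans hc)).some
  | succ i =>
      have hi : i < cs.length := by omega
      have hci : (cs[i]).1 = mkC l[i] := by
        have h1 := List.getElem_of_eq hcs (i := i) (by simpa using hi)
        simp only [List.getElem_map] at h1
        exact h1
      rw [letter_rep_succ c cs i hi, letter_eq_getElem P l (i + 1) (by simpa using hk), List.getElem_cons_succ]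
      exact (mkC_eq_mkC_iff.1 ((mkC_rep (cs[i]).1).trans hci)).some

/-- **THE BIJECTION BEHIND THE REGROUPING (1.21)**: «connected two-point graph ↦ its string of proper insertions» is a bijection
between the isomorphism classes of unglueable two-leg insertions of p18's model and the nonempty strings (head, tail) of
isomorphism classes of letters — decompose (`isoChainPieces`, `pieceIsoLetter`) and glue (p37's `chain`) are mutually inverse up
to isomorphism. [cite: Balaban1983Higgs3, (1.21) p.416] -/
noncomputable def classEquiv : UnglueableClass nbar ≃ LetterClass nbar × List (LetterClass nbar) where
  toFun := decompose
  invFun := glue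
  left_inv x := by
    obtain ⟨q, hq⟩ := x
    apply Subtype.ext
    have hU : Unglueable (rep q) := unglueable_rep hq
    change (glue (pieceClasses (rep q) hU)).1 = q
    rw [glue_val_eq_mkC_chain (P := headPiece (rep q) hU) (l := tailPieces (rep q) hU) rfl
      (by simp only [pieceClasses, tailPieces, List.map_ofFn]; rfl)]
    conv_rhs => rw [← mkC_rep q]
    exact mkC_eq_mkC_iff.2 ⟨(isoChainPieces (rep q) hU).symm⟩
  right_inv x := by
    obtain ⟨c, cs⟩ := x
    have hl := isLetter_letter_rep c cs
    have hUC : Unglueable (chain (rep c.1) (cs.map fun c => rep c.1)) := unglueable_chain hl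
    have hdec : decompose (glue (c, cs)) = pieceClasses _ hUC := decompose_mkC _ hUC
    rw [hdec]
    have hm : Ns (chain (rep c.1) (cs.map fun c => rep c.1)) = cs.length := by
      rw [numSep_chain_of_letters hl]; simp
    -- piece `k` of the glued chain ≅ its `k`-th letter = the representative of the `k`-th class
    have key : ∀ (k : ℕ) (hk : k ≤ Ns (chain (rep c.1) (cs.map fun c => rep c.1))),
        mkC (piece _ hUC k hk) = mkC (letter (rep c.1) (cs.map fun c => rep c.1) k) := fun k hk =>
      mkC_eq_mkC_iff.2 ⟨pieceIsoLetter hl hUC (TwoLegGraphIso.refl _) k hk⟩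
    refine Prod.ext (Subtype.ext ?_) (List.ext_getElem (by simp [pieceClasses, hm]) fun i h₁ h₂ => ?_)
    · change mkC (piece _ hUC 0 _) = c.1
      rw [key 0, letter_zero, mkC_rep]
    · simp only [pieceClasses, List.getElem_ofFn]
      apply Subtype.ext
      change mkC (piece _ hUC (i + 1) _) = (cs[i]).1
      rw [key (i + 1), letter_rep_succ c cs i h₂, mkC_rep]

/-- kernel: `classEquiv` is `decompose`. [cite: Balaban1983Higgs3, (1.21) p.416] -/
theorem classEquiv_apply (x : UnglueableClass nbar) : classEquiv x = decompose x := rfl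

/-- kernel: `classEquiv.symm` is `glue`. [cite: Balaban1983Higgs3, (1.21) p.416] -/
theorem classEquiv_symm_apply (x : LetterClass nbar × List (LetterClass nbar)) : classEquiv.symm x = glue x := rfl

/-- **on the class of a concrete insertion**: `classEquiv ⟦T⟧ = (⟦V_0⟧, [⟦V_1⟧, …, ⟦V_m⟧])`, the classes of its pieces.
[cite: Balaban1983Higgs3, (1.21) p.416] -/
theorem classEquiv_mkC (T : TwoLegGraph nbar) (hU : Unglueable T) :
    classEquiv ⟨mkC T, unglueableC_mkC.2 hU⟩ = pieceClasses T hU :=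
  decompose_mkC T hU

/-- **on the classes of concrete letters**: `classEquiv.symm (⟦P⟧, [⟦l₁⟧, …, ⟦l_r⟧]) = ⟦chain P [l₁, …, l_r]⟧`.
[cite: Balaban1983Higgs3, (1.21) p.416] -/
theorem classEquiv_symm_val {P : TwoLegGraph nbar} {l : List (TwoLegGraph nbar)} {c : LetterClass nbar}
    {cs : List (LetterClass nbar)} (hc : c.1 = mkC P) (hcs : cs.map Subtype.val = l.map mkC) :
    (classEquiv.symm (c, cs)).1 = mkC (chain P l) :=
  glue_val_eq_mkC_chain hc hcs

/-! ## §6 The index bijection in the shape BRICK 2 consumes (`γ ≃ List ι`) -/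

/-- **THE INDEX BIJECTION OF (1.21) IN THE SHAPE `γ ≃ List ι`** of BRICK 2
(`B3Eq121OnePIChainsLetters.sigmaSeries_eq_greenSeries_of_equiv`):
the connected two-point objects of the model regrouped by (1.21) — the bare line `C₀^ε` (the `n = 0` term; the extra point `none`,
not a graph: p. 415 *"There is at least one internal line"*) and the isomorphism classes of unglueable two-leg insertions — are in
bijection with the strings of letter classes, `C₀^ε ↦ []`, `⟦T⟧ ↦ [⟦V_0⟧, …, ⟦V_m⟧]` — `classEquiv` composed with p37 g108's term
index `B3OnePIChainAmplitude.chainIndexEquiv : Option (κ × List κ) ≃ List κ` at `κ = LetterClass n̄`.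
[cite: Balaban1983Higgs3, (1.21) p.416] -/
noncomputable def classEquivList : Option (UnglueableClass nbar) ≃ List (LetterClass nbar) :=
  (Equiv.optionCongr classEquiv).trans (B3OnePIChainAmplitude.chainIndexEquiv (LetterClass nbar))

/-- kernel: `classEquivList none = []` (the bare propagator is the empty string of letters).
[cite: Balaban1983Higgs3, (1.21) p.416] -/
@[simp] theorem classEquivList_none : classEquivList (nbar := nbar) none = [] := rfl

/-- kernel: `classEquivList (some x) = (decompose x).1 :: (decompose x).2`. [cite: Balaban1983Higgs3, (1.21) p.416] -/
theorem classEquivList_some (x : UnglueableClass nbar) : classEquivList (some x) = (decompose x).1 :: (decompose x).2 := rfl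

/-- kernel: the string of an insertion has `numSep + 1` letters — the class of `T` indexes a term of the `n = numSep T + 1` summand
of (1.21). [cite: Balaban1983Higgs3, (1.21) p.416] -/
theorem length_classEquivList_some_mkC (T : TwoLegGraph nbar) (hU : Unglueable T) :
    (classEquivList (some ⟨mkC T, unglueableC_mkC.2 hU⟩)).length = Ns T + 1 := by
  rw [classEquivList_some, ← classEquiv_apply, classEquiv_mkC T hU]
  simp [pieceClasses]

end Literature.MathematicalPhysics.QuantumFieldTheory.Balaban1983to89.B3OnePIChainClasses
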